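import Literature.Analysis.FluidPDE.LThetaEnergyIdentities
import Literature.Analysis.FluidPDE.BeiraoDaVeigaEnstrophyGronwall
import HarnessLib

/-!
# The `L⁴` energy estimate with the pressure in `L^r(ℝ³)`, `3/2 < r < ∞` (Lemarié-Rieusset, Prop. 11.7)

Analysis/FluidPDE proof file (theorems only: no definition, no named fact, no `sorry`).
Search for candidate a priori estimates; no regularity claim. This is the time-slice estimate of
the `L⁴` ENERGY METHOD in the proof of the pressure regularity criterion
`∇p ∈ L^s_t L^q_x`, `2/s + 3/q = 3`, `1 < q < 3` (Berselli–Galdi 2002 / Zhou 2004–2006, as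
presented in Lemarié-Rieusset 2016, §11.5 Prop. 11.7), the brick between the slice identity
`Literature.Analysis.FluidPDE.integral_norm_rpow_inner_eq_of_momentum` (`LThetaEnergyIdentities`,
at `θ = 4`: `d/dt‖u‖₄⁴ = -4ν∫|u|²|∇⊗u|² - 8ν∫Σᵢ(∂ᵢu·u)² + 8∫ϖ u·((u·∇)u)`, LR (11.46)–(11.47))
and the slab Grönwall inequality on `t ↦ ‖u(t)‖₄⁴` of the named fact
`Literature.Analysis.FluidPDE.pressureGradientCriterion` (`GradientRegularityCriteria`).

With the pressure measured in `L^r`, `r = 3q/(3-q) ∈ (3/2, ∞)` (Sobolev, `‖ϖ‖_r ≲ ‖∇ϖ‖_q`), LR's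
chain (11.47)–(11.50) reads, for one slice `v = u(t)`, `ϖ` the normalised pressure,
`E = ∫‖v‖⁴`, `𝒢 = ∫Σᵢ⟪v, ∂ᵢv⟫² = ¼‖∇|v|²‖₂²`:

* `|∫ ϖ ⟪v,(v·∇)v⟫| ≤ (∫ϖ²‖v‖²)^{1/2} 𝒢^{1/2}` (Cauchy–Schwarz, LR (11.49);
  `abs_integral_mul_inner_convect_le`);
* `∫ ϖ²‖v‖² ≤ ‖ϖ‖_r ‖ϖ‖_m ‖|v|²‖_m ≤ C_S ‖ϖ‖_r ‖|v|²‖_m²`, `m = 2r/(r-1)` (Hölder — LR's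
  "`2/σ = ½(1 - 1/r)`", `σ = 2m`, `‖ϖu‖₂ ≤ ‖ϖ‖_r^{1/2}‖ϖ‖_{σ/2}^{1/2}‖u‖_σ` — and the
  Calderón–Zygmund bound `‖ϖ‖_m ≤ C_S‖v‖²_{2m}`, Stein 1970 — a HYPOTHESIS here, supplied downstream
  by `exists_eLpNorm_normalisedPressure_le_sq`), and `‖|v|²‖_m² ≤ E^{1-3/(2r)} (K²·4𝒢)^{3/(2r)}`
  (Lebesgue interpolation between `L²` and `L⁶` and the Sobolev inequality for `|v|²`, LR's
  `‖u‖_σ² ≤ C‖u‖₄^{·}‖|u|²‖_{Ḣ¹}^{·}` step) — `integral_sq_mul_sq_norm_le_of_eLpNorm_le`;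
* Young: `8|∫ϖ⟪v,(v·∇)v⟫| ≤ 4ν𝒢 + C ν^{1-1/Θ} (C_S‖ϖ‖_r)^{1/θ} E`, `θ = 1 - 3/(2r)`, `Θ = θ/2`,
  `1/θ = 2r/(2r-3) = λ = p` the time exponent of LR (11.50) (`2/p + 3/r = 2` for the pressure,
  i.e. `2/s + 3/q = 3` for its gradient, `r = 3q/(3-q)`), whence the slice inequality
  `∫ 4‖v‖²⟪v, ∂ₜv⟫ ≤ C(θ,K) (8ν)^{-(1-Θ)/Θ} (C_S‖ϖ‖_r)^{1/θ} ∫‖v‖⁴`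
  (`lfour_slice_le_of_momentum`, `lfour_slice_le_of_momentum'`), the dissipation being dropped.

Everything is stated for a single `C²` bounded divergence-free slice `v` with `v, Dv, D²v ∈ L²`
and a `C¹` scalar `q` with `q, Dq ∈ L²`, `q ∈ L^r` — the regularity available on Tao's
classical class — with `K` Mathlib's Sobolev constant `SNormLESNormFDerivOfEqConst ℝ volume 2` for
real functions on `ℝ³`. The case `q ≥ 3` of Prop. 11.7 (`L^θ` energy, `θ = 3q - 2`) is not in this
file.

## References

* [LemarieRieusset2016] P. G. Lemarié-Rieusset, *The Navier–Stokes problem in the 21st century*,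
  CRC Press 2016 — §11.5, Prop. 11.7 and its proof, (11.46)–(11.50) (PDF pp. 363–364).
* [BerselliGaldi2002] L. C. Berselli, G. P. Galdi, Proc. AMS 130 (2002) 3585–3595 — Thm. 1.1.
* [Stein1970] E. M. Stein, *Singular integrals and differentiability properties of functions*,
  Princeton 1970 — Ch. III §1.2 Thm. 1 (the `L^p` bound behind the hypothesis `hRz`).
-/

noncomputable section

open MeasureTheory Set Function Filter Topology InnerProductSpace
open scoped ENNReal NNReal ContDiff RealInnerProductSpace Laplacian

namespace Literature.Analysis.FluidPDE

section Pointwise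

/-- **Pointwise Cauchy–Schwarz for the self-transport density**:
`|⟪v, (v·∇)v⟫| ≤ ‖v‖ (Σᵢ ⟪v, ∂ᵢv⟫²)^{1/2}` (expand `(v·∇)v = Σᵢ vᵢ ∂ᵢv` in the standard basis).
[folklore] -/
private theorem abs_inner_convect_self_le
    {v : EuclideanSpace ℝ (Fin 3) → EuclideanSpace ℝ (Fin 3)} (x : EuclideanSpace ℝ (Fin 3)) :
    |⟪v x, FluidPDE.convect v v x⟫| ≤
      ‖v x‖ * Real.sqrt (∑ i, ⟪v x, fderiv ℝ v x (EuclideanSpace.basisFun (Fin 3) ℝ i)⟫ ^ 2) := by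
  set e := EuclideanSpace.basisFun (Fin 3) ℝ with he
  have hrepr : ∑ i, ⟪e i, v x⟫ • e i = v x := e.sum_repr' (v x)
  have hDv : FluidPDE.convect v v x = ∑ i, ⟪e i, v x⟫ • fderiv ℝ v x (e i) := by
    rw [FluidPDE.convect]
    calc fderiv ℝ v x (v x) = fderiv ℝ v x (∑ i, ⟪e i, v x⟫ • e i) := by rw [hrepr]
      _ = ∑ i, ⟪e i, v x⟫ • fderiv ℝ v x (e i) := by
          rw [map_sum]
          exact Finset.sum_congr rfl fun i _ => by rw [map_smul]
  have hsum : ⟪v x, FluidPDE.convect v v x⟫ = ∑ i, ⟪e i, v x⟫ * ⟪v x, fderiv ℝ v x (e i)⟫ := by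
    rw [hDv, inner_sum]
    exact Finset.sum_congr rfl fun i _ => by rw [inner_smul_right]
  rw [hsum]
  have hnorm : Real.sqrt (∑ i, |⟪e i, v x⟫| ^ 2) = ‖v x‖ := by
    simp_rw [sq_abs]
    rw [e.sum_sq_inner_right, Real.sqrt_sq (norm_nonneg _)]
  calc |∑ i, ⟪e i, v x⟫ * ⟪v x, fderiv ℝ v x (e i)⟫|
      ≤ ∑ i, |⟪e i, v x⟫ * ⟪v x, fderiv ℝ v x (e i)⟫| := Finset.abs_sum_le_sum_abs _ _
    _ = ∑ i, |⟪e i, v x⟫| * |⟪v x, fderiv ℝ v x (e i)⟫| :=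
        Finset.sum_congr rfl fun i _ => abs_mul _ _
    _ ≤ Real.sqrt (∑ i, |⟪e i, v x⟫| ^ 2) * Real.sqrt (∑ i, |⟪v x, fderiv ℝ v x (e i)⟫| ^ 2) :=
        Real.sum_mul_le_sqrt_mul_sqrt _ _ _
    _ = ‖v x‖ * Real.sqrt (∑ i, ⟪v x, fderiv ℝ v x (e i)⟫ ^ 2) := by
        rw [hnorm]
        simp_rw [sq_abs]

/-- `D(‖v‖²)(x) h = 2 ⟪v x, Dv(x) h⟫`. [folklore] -/
private theorem fderiv_norm_sq_apply'
    {v : EuclideanSpace ℝ (Fin 3) → EuclideanSpace ℝ (Fin 3)} {x : EuclideanSpace ℝ (Fin 3)}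
    (hd : DifferentiableAt ℝ v x) (h : EuclideanSpace ℝ (Fin 3)) :
    fderiv ℝ (fun y => ‖v y‖ ^ 2) x h = 2 * ⟪v x, fderiv ℝ v x h⟫ := by
  rw [hd.hasFDerivAt.norm_sq.fderiv]
  simp [innerSL_apply_apply]

/-- `‖D(‖v‖²)(x)‖² ≤ 4 Σᵢ ⟪v x, ∂ᵢv(x)⟫²` (operator norm against the standard frame). [folklore] -/
private theorem sq_norm_fderiv_norm_sq_le
    {v : EuclideanSpace ℝ (Fin 3) → EuclideanSpace ℝ (Fin 3)} {x : EuclideanSpace ℝ (Fin 3)}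
    (hd : DifferentiableAt ℝ v x) :
    ‖fderiv ℝ (fun y => ‖v y‖ ^ 2) x‖ ^ 2 ≤
      4 * ∑ i, ⟪v x, fderiv ℝ v x (EuclideanSpace.basisFun (Fin 3) ℝ i)⟫ ^ 2 := by
  set e := EuclideanSpace.basisFun (Fin 3) ℝ with he
  refine (FluidPDE.sq_opNorm_le_sum_sq_norm_apply e (fderiv ℝ (fun y => ‖v y‖ ^ 2) x)).trans ?_
  rw [Finset.mul_sum]
  refine le_of_eq (Finset.sum_congr rfl fun i _ => ?_)
  rw [fderiv_norm_sq_apply' hd, Real.norm_eq_abs, sq_abs]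
  ring

end Pointwise

/-! ### The key estimate `∫ q² ‖v‖² ≤ C_S ‖q‖_r E^{1-3/(2r)} (4K² 𝒢)^{3/(2r)}` -/

section KeyEstimate

/-- Exponent algebra (copy of the Beirão da Veiga bookkeeping): for `ρ > 3/2` and
`m = 2ρ/(ρ-1)`, `2 < m < 6`, `(ρ, m/2)` are Hölder conjugate, and the interpolation exponents
between `L²` and `L⁶` at `L^m`, multiplied by `2/m`, are `1 - 3/(2ρ)` and `1/(2ρ)`. [folklore] -/
private theorem lfour_exponent_algebra {ρ : ℝ} (hρ : 3 / 2 < ρ) :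
    let m : ℝ := 2 * ρ / (ρ - 1)
    2 < m ∧ m < 6 ∧ ρ.HolderConjugate (m / 2) ∧
      (6 - m) / (6 - 2) * (2 / m) = 1 - 3 / (2 * ρ) ∧ (m - 2) / (6 - 2) * (2 / m) = 1 / (2 * ρ) := by
  intro m
  have hρ1 : 0 < ρ - 1 := by linarith
  have hρ0 : 0 < ρ := by linarith
  have hm : m = 2 * ρ / (ρ - 1) := rfl
  refine ⟨?_, ?_, ?_, ?_, ?_⟩
  · rw [hm, lt_div_iff₀ hρ1]; linarith
  · rw [hm, div_lt_iff₀ hρ1]; linarith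
  · rw [Real.holderConjugate_iff]
    refine ⟨by linarith, ?_⟩
    rw [hm]; field_simp; ring
  · rw [hm]; field_simp; ring
  · rw [hm]; field_simp; ring
set_option maxHeartbeats 400000 in -- buildfix (bf3-g25): 160k/180k FAIL, 200k PASS at accept time; line-neutral budget line
/-- **The key estimate of the `L⁴` energy method** (Lemarié-Rieusset 2016, proof of Prop. 11.7,
the display after (11.49): with `2/σ = ½(1 - 1/r)`,
`‖ϖu‖₂ ≤ ‖ϖ‖_r^{1/2} ‖ϖ‖_{σ/2}^{1/2} ‖u‖_σ`, `‖ϖ‖_{σ/2} ≤ C‖u‖_σ²`, and `‖u‖_σ²` interpolated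
between `‖u‖₄²` and `‖|u|²‖_{Ḣ¹}`; here `m = σ/2 = 2r/(r-1)` and `1 - 3/(2r)` is the weight of
`‖u‖₄⁴`). For a `C¹` bounded field `v : ℝ³ → ℝ³` with
`v, Dv ∈ L²`, a continuous `q ∈ L² ∩ L^r`, `3/2 < r < ∞`, and the Calderón–Zygmund-type hypothesis
`‖q‖_{L^{m}} ≤ C_S ‖v‖²_{L^{2m}}`, `m = 2r/(r-1)` (for the normalised pressure this is Stein 1970
III.1.2 Thm 1, the tree's `exists_eLpNorm_normalisedPressure_le_sq`):
`∫ q² ‖v‖² ≤ C_S ‖q‖_{L^r} (∫‖v‖⁴)^{1-3/(2r)} (K² · 4∫Σᵢ⟪v,∂ᵢv⟫²)^{3/(2r)}`,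
`K` the Sobolev constant of `‖w‖_{L⁶} ≤ K‖Dw‖_{L²}` for real functions on `ℝ³`. Proof in `ℝ≥0∞`:
Hölder `(r, m/2)` on `|q|·(|q|‖v‖²)`, Hölder `(2, 2)` on `|q|^{m/2}·‖v‖^m`, the hypothesis,
Lebesgue interpolation of `∫(‖v‖²)^m` between `2` and `6` (`lintegral_rpow_interpolate`), Sobolev
for `w = ‖v‖²` (`eLpNorm_six_le_eLpNorm_fderiv_two`) and `‖D(‖v‖²)‖² ≤ 4Σᵢ⟪v,∂ᵢv⟫²`.
[cite: LemarieRieusset2016, §11.5 Prop. 11.7 proof, display after (11.49) (PDF p. 364)] -/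
theorem integral_sq_mul_sq_norm_le_of_eLpNorm_le
    {v : EuclideanSpace ℝ (Fin 3) → EuclideanSpace ℝ (Fin 3)} (hv : ContDiff ℝ 1 v)
    {B : ℝ} (hB : ∀ x, ‖v x‖ ≤ B)
    (hv0 : ∫⁻ x, ‖v x‖ₑ ^ 2 < ⊤) (hv1 : ∫⁻ x, ‖iteratedFDeriv ℝ 1 v x‖ₑ ^ 2 < ⊤)
    {q : EuclideanSpace ℝ (Fin 3) → ℝ} (hqc : Continuous q) (hq0 : ∫⁻ x, ‖q x‖ₑ ^ 2 < ⊤)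
    {r : ℝ≥0∞} (hr : 3 / 2 < r) (hrtop : r ≠ ⊤) (hqr : eLpNorm q r volume < ⊤)
    {CS : ℝ≥0}
    (hRz : eLpNorm q (ENNReal.ofReal (2 * r.toReal / (r.toReal - 1))) volume ≤
      CS * eLpNorm v (ENNReal.ofReal (2 * (2 * r.toReal / (r.toReal - 1)))) volume ^ 2) :
    ∫ x, q x ^ 2 * ‖v x‖ ^ 2 ≤
      CS * (eLpNorm q r volume).toReal * (∫ x, ‖v x‖ ^ 4) ^ (1 - 3 / (2 * r.toReal)) *
        ((SNormLESNormFDerivOfEqConst ℝ (volume : Measure (EuclideanSpace ℝ (Fin 3))) 2 : ℝ) ^ 2 *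
          (4 * ∫ x, ∑ i, ⟪v x, fderiv ℝ v x (EuclideanSpace.basisFun (Fin 3) ℝ i)⟫ ^ 2)) ^
          (3 / (2 * r.toReal)) := by
  set e := EuclideanSpace.basisFun (Fin 3) ℝ with he
  set K : ℝ≥0 := SNormLESNormFDerivOfEqConst ℝ (volume : Measure (EuclideanSpace ℝ (Fin 3))) 2
    with hK
  -- the real exponents
  have hr0 : r ≠ 0 := (lt_trans (by norm_num) hr).ne'
  set ρ : ℝ := r.toReal with hρ
  have hρ3 : 3 / 2 < ρ := by
    have h : ((3 / 2 : ℝ≥0∞)).toReal < r.toReal :=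
      (ENNReal.toReal_lt_toReal (ENNReal.div_ne_top (by norm_num) (by norm_num)) hrtop).2 hr
    have h32 : ((3 / 2 : ℝ≥0∞)).toReal = 3 / 2 := by
      rw [ENNReal.toReal_div, ENNReal.toReal_ofNat, ENNReal.toReal_ofNat]
    rw [h32] at h
    exact h
  have hρ0 : 0 < ρ := by linarith
  obtain ⟨h2m, hm6, hconj, hexpθ, hexp1⟩ := lfour_exponent_algebra hρ3
  set m : ℝ := 2 * ρ / (ρ - 1) with hm
  have hm0 : 0 < m := by linarith
  have hB0 : 0 ≤ B := (norm_nonneg _).trans (hB 0)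
  -- continuity and pointwise bounds
  have cv : Continuous v := hv.continuous
  have cdv : ∀ i, Continuous fun x => fderiv ℝ v x (e i) := fun i =>
    (hv.continuous_fderiv one_ne_zero).clm_apply continuous_const
  have n_dv : ∀ i x, ‖fderiv ℝ v x (e i)‖ ≤ ‖iteratedFDeriv ℝ 1 v x‖ := fun i x =>
    norm_fderiv_apply_basisFun_le v x i
  -- the function `w = ‖v‖²` and the density `G = Σᵢ ⟪v, ∂ᵢv⟫²`
  set w : EuclideanSpace ℝ (Fin 3) → ℝ := fun x => ‖v x‖ ^ 2 with hw
  have hw1 : ContDiff ℝ 1 w := hv.norm_sq ℝ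
  have cw : Continuous w := hw1.continuous
  set G : EuclideanSpace ℝ (Fin 3) → ℝ := fun x => ∑ i, ⟪v x, fderiv ℝ v x (e i)⟫ ^ 2 with hG
  have hG0 : ∀ x, 0 ≤ G x := fun x => Finset.sum_nonneg fun i _ => sq_nonneg _
  have cG : Continuous G :=
    continuous_finsetSum _ fun i _ => (cv.inner (cdv i)).pow 2
  -- integrability of the real quantities
  have i_v2 : Integrable (fun x => ‖v x‖ ^ 2) volume :=
    FluidPDE.integrable_sq_norm_of_lintegral_lt_top cv hv0
  have i_E : Integrable (fun x => ‖v x‖ ^ 4) volume := by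
    have hdom : Integrable (fun x => B ^ 2 * ‖v x‖ ^ 2) volume := i_v2.const_mul _
    refine hdom.mono' (cv.norm.pow 4).aestronglyMeasurable (Eventually.of_forall fun x => ?_)
    rw [Real.norm_of_nonneg (by positivity)]
    have h1 : ‖v x‖ ^ 4 = ‖v x‖ ^ 2 * ‖v x‖ ^ 2 := by ring
    rw [h1]
    exact mul_le_mul_of_nonneg_right (pow_le_pow_left₀ (norm_nonneg _) (hB x) 2) (sq_nonneg _)
  have i_q2 : Integrable (fun x => q x ^ 2) volume := by
    have h := FluidPDE.integrable_sq_norm_of_lintegral_lt_top hqc hq0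
    refine h.congr (Eventually.of_forall fun x => ?_)
    simp only [Real.norm_eq_abs, sq_abs]
  have i_P : Integrable (fun x => q x ^ 2 * ‖v x‖ ^ 2) volume := by
    have hdom : Integrable (fun x => B ^ 2 * q x ^ 2) volume := i_q2.const_mul _
    refine hdom.mono' ((hqc.pow 2).mul (cv.norm.pow 2)).aestronglyMeasurable
      (Eventually.of_forall fun x => ?_)
    rw [Real.norm_of_nonneg (by positivity), mul_comm (B ^ 2)]
    exact mul_le_mul_of_nonneg_left (pow_le_pow_left₀ (norm_nonneg _) (hB x) 2) (sq_nonneg _)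
  have i_G : Integrable G volume := by
    have i_d1 : Integrable (fun x => ‖iteratedFDeriv ℝ 1 v x‖ ^ 2) volume :=
      FluidPDE.integrable_sq_norm_of_lintegral_lt_top
        ((hv.continuous_iteratedFDeriv le_rfl)) hv1
    have hdom : Integrable (fun x => 3 * (B ^ 2 * ‖iteratedFDeriv ℝ 1 v x‖ ^ 2)) volume :=
      (i_d1.const_mul _).const_mul _
    refine hdom.mono' cG.aestronglyMeasurable (Eventually.of_forall fun x => ?_)
    rw [Real.norm_of_nonneg (hG0 x), hG]
    dsimp only
    have hterm : ∀ i, ⟪v x, fderiv ℝ v x (e i)⟫ ^ 2 ≤ B ^ 2 * ‖iteratedFDeriv ℝ 1 v x‖ ^ 2 := by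
      intro i
      rw [← mul_pow]
      have h := abs_real_inner_le_norm (v x) (fderiv ℝ v x (e i))
      calc ⟪v x, fderiv ℝ v x (e i)⟫ ^ 2 = |⟪v x, fderiv ℝ v x (e i)⟫| ^ 2 := (sq_abs _).symm
        _ ≤ (‖v x‖ * ‖fderiv ℝ v x (e i)‖) ^ 2 := pow_le_pow_left₀ (abs_nonneg _) h 2
        _ ≤ (B * ‖iteratedFDeriv ℝ 1 v x‖) ^ 2 :=
            pow_le_pow_left₀ (by positivity)
              (mul_le_mul (hB x) (n_dv i x) (norm_nonneg _) hB0) 2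
    calc ∑ i, ⟪v x, fderiv ℝ v x (e i)⟫ ^ 2 ≤ ∑ _i : Fin 3, B ^ 2 * ‖iteratedFDeriv ℝ 1 v x‖ ^ 2 :=
          Finset.sum_le_sum fun i _ => hterm i
      _ = 3 * (B ^ 2 * ‖iteratedFDeriv ℝ 1 v x‖ ^ 2) := by simp
  -- names of the real quantities
  set E : ℝ := ∫ x, ‖v x‖ ^ 4 with hE
  set R : ℝ := 4 * ∫ x, G x with hR
  have hE0 : 0 ≤ E := integral_nonneg fun x => by positivity
  have hR0 : 0 ≤ R := mul_nonneg (by norm_num) (integral_nonneg hG0)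
  -- `ℝ≥0∞` renderings
  have hwn : ∀ x, ‖w x‖ₑ = ‖v x‖ₑ ^ (2 : ℝ) := fun x => by
    rw [hw]
    dsimp only
    rw [Real.enorm_eq_ofReal (sq_nonneg _), ← Real.rpow_two, ← ofReal_norm,
      ENNReal.ofReal_rpow_of_nonneg (norm_nonneg _) (by norm_num)]
  have hEw : ENNReal.ofReal E = ∫⁻ x, ‖w x‖ₑ ^ (2 : ℝ) := by
    rw [hE, ofReal_integral_eq_lintegral_ofReal i_E (Eventually.of_forall fun x => by positivity)]
    refine lintegral_congr fun x => ?_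
    rw [hwn, ← ENNReal.rpow_mul, ← ofReal_norm,
      ENNReal.ofReal_rpow_of_nonneg (norm_nonneg _) (by norm_num : (0 : ℝ) ≤ 2 * 2)]
    congr 1
    rw [show ((2 : ℝ) * 2) = ((4 : ℕ) : ℝ) by norm_num, Real.rpow_natCast]
  have l2w : ∫⁻ x, ‖w x‖ₑ ^ 2 < ⊤ := by
    have h : ∫⁻ x, ‖w x‖ₑ ^ (2 : ℝ) < ⊤ := by rw [← hEw]; exact ENNReal.ofReal_lt_top
    simp_rw [ENNReal.rpow_two] at h
    exact h
  have hDw : eLpNorm (fderiv ℝ w) 2 volume ^ 2 ≤ ENNReal.ofReal R := by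
    rw [← lintegral_enorm_sq_eq_eLpNorm_two_sq, hR, ← integral_const_mul,
      ofReal_integral_eq_lintegral_ofReal (i_G.const_mul _)
        (Eventually.of_forall fun x => mul_nonneg (by norm_num) (hG0 x))]
    refine lintegral_mono fun x => ?_
    rw [← ofReal_norm, ← ENNReal.ofReal_pow (norm_nonneg _)]
    exact ENNReal.ofReal_le_ofReal (sq_norm_fderiv_norm_sq_le (hv.differentiable one_ne_zero x))
  have hP : ENNReal.ofReal (∫ x, q x ^ 2 * ‖v x‖ ^ 2) =
      ∫⁻ x, ‖q x‖ₑ * (‖q x‖ₑ * ‖v x‖ₑ ^ (2 : ℝ)) := by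
    rw [ofReal_integral_eq_lintegral_ofReal i_P (Eventually.of_forall fun x => by positivity)]
    refine lintegral_congr fun x => ?_
    rw [ENNReal.rpow_two, ENNReal.ofReal_mul (sq_nonneg _), ← sq_abs (q x), ← Real.norm_eq_abs,
      ENNReal.ofReal_pow (norm_nonneg _), ENNReal.ofReal_pow (norm_nonneg _), ofReal_norm,
      ofReal_norm]
    ring
  -- Sobolev for `w`: `∫⁻ ‖w‖ₑ⁶ ≤ (K² R)³`
  have hS : eLpNorm w 6 volume ≤ K * eLpNorm (fderiv ℝ w) 2 volume :=
    FluidPDE.eLpNorm_six_le_eLpNorm_fderiv_two volume finrank_euclideanSpace_fin hw1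
      (eLpNorm_two_lt_top_of_lintegral_enorm_sq_lt_top l2w)
  have hS6 : ∫⁻ x, ‖w x‖ₑ ^ (6 : ℝ) ≤ ((K : ℝ≥0∞) ^ 2 * ENNReal.ofReal R) ^ (3 : ℝ) := by
    have h6 : ∫⁻ x, ‖w x‖ₑ ^ (6 : ℝ) = eLpNorm w 6 volume ^ (6 : ℝ) := by
      rw [eLpNorm_eq_lintegral_rpow_enorm_toReal (by norm_num) (by norm_num), ENNReal.toReal_ofNat,
        ← ENNReal.rpow_mul]
      norm_num
    rw [h6]
    calc eLpNorm w 6 volume ^ (6 : ℝ) ≤ (K * eLpNorm (fderiv ℝ w) 2 volume) ^ (6 : ℝ) := by gcongr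
      _ = ((K : ℝ≥0∞) ^ 2 * eLpNorm (fderiv ℝ w) 2 volume ^ 2) ^ (3 : ℝ) := by
          rw [← mul_pow, ← ENNReal.rpow_natCast, ← ENNReal.rpow_mul]; norm_num
      _ ≤ ((K : ℝ≥0∞) ^ 2 * ENNReal.ofReal R) ^ (3 : ℝ) := by gcongr
  -- Hölder `(ρ, m/2)` on `|q| · (|q| ‖v‖²)`
  have cqe : AEMeasurable (fun x => ‖q x‖ₑ) volume := hqc.aemeasurable.enorm
  have cve : AEMeasurable (fun x => ‖v x‖ₑ) volume := cv.aemeasurable.enorm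
  have hH1 : ∫⁻ x, ‖q x‖ₑ * (‖q x‖ₑ * ‖v x‖ₑ ^ (2 : ℝ)) ≤
      (∫⁻ x, ‖q x‖ₑ ^ ρ) ^ (1 / ρ) * (∫⁻ x, (‖q x‖ₑ * ‖v x‖ₑ ^ (2 : ℝ)) ^ (m / 2)) ^ (2 / m) := by
    have h := ENNReal.lintegral_mul_le_Lp_mul_Lq volume hconj
      (f := fun x => ‖q x‖ₑ) (g := fun x => ‖q x‖ₑ * ‖v x‖ₑ ^ (2 : ℝ))
      cqe (cqe.mul (cve.pow_const _))
    have e2 : 1 / (m / 2) = 2 / m := by field_simp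
    simp only [Pi.mul_apply] at h
    rwa [e2] at h
  -- Hölder `(2, 2)` on `|q|^{m/2} · ‖v‖^m`
  have hH2 : (∫⁻ x, (‖q x‖ₑ * ‖v x‖ₑ ^ (2 : ℝ)) ^ (m / 2)) ^ (2 / m) ≤
      (∫⁻ x, ‖q x‖ₑ ^ m) ^ (1 / m) * (∫⁻ x, ‖v x‖ₑ ^ (2 * m)) ^ (1 / m) := by
    have hsplit : ∀ x, (‖q x‖ₑ * ‖v x‖ₑ ^ (2 : ℝ)) ^ (m / 2) =
        ‖q x‖ₑ ^ (m / 2) * ‖v x‖ₑ ^ m := fun x => by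
      rw [ENNReal.mul_rpow_of_nonneg _ _ (by positivity), ← ENNReal.rpow_mul]
      congr 2; field_simp
    simp_rw [hsplit]
    have h := ENNReal.lintegral_mul_le_Lp_mul_Lq volume Real.HolderConjugate.two_two
      (f := fun x => ‖q x‖ₑ ^ (m / 2)) (g := fun x => ‖v x‖ₑ ^ m)
      (cqe.pow_const _) (cve.pow_const _)
    simp only [Pi.mul_apply] at h
    have hf2 : ∀ x, (‖q x‖ₑ ^ (m / 2)) ^ (2 : ℝ) = ‖q x‖ₑ ^ m := fun x => by
      rw [← ENNReal.rpow_mul]; congr 1; field_simp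
    have hg2 : ∀ x, (‖v x‖ₑ ^ m) ^ (2 : ℝ) = ‖v x‖ₑ ^ (2 * m) := fun x => by
      rw [← ENNReal.rpow_mul]; congr 1; ring
    simp_rw [hf2, hg2] at h
    calc (∫⁻ x, ‖q x‖ₑ ^ (m / 2) * ‖v x‖ₑ ^ m) ^ (2 / m)
        ≤ ((∫⁻ x, ‖q x‖ₑ ^ m) ^ (1 / (2 : ℝ)) * (∫⁻ x, ‖v x‖ₑ ^ (2 * m)) ^ (1 / (2 : ℝ))) ^ (2 / m) := by
          gcongr
      _ = (∫⁻ x, ‖q x‖ₑ ^ m) ^ (1 / m) * (∫⁻ x, ‖v x‖ₑ ^ (2 * m)) ^ (1 / m) := by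
          rw [ENNReal.mul_rpow_of_nonneg _ _ (by positivity), ← ENNReal.rpow_mul,
            ← ENNReal.rpow_mul]
          congr 2 <;> field_simp
  -- the Calderón–Zygmund-type hypothesis in `lintegral` form
  have hmtop : ENNReal.ofReal m ≠ ⊤ := ENNReal.ofReal_ne_top
  have hm0' : ENNReal.ofReal m ≠ 0 := (ENNReal.ofReal_pos.2 hm0).ne'
  have h2m0' : ENNReal.ofReal (2 * m) ≠ 0 := (ENNReal.ofReal_pos.2 (by positivity)).ne'
  have hRz' : (∫⁻ x, ‖q x‖ₑ ^ m) ^ (1 / m) ≤ CS * (∫⁻ x, ‖v x‖ₑ ^ (2 * m)) ^ (1 / m) := by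
    have hq : eLpNorm q (ENNReal.ofReal m) volume = (∫⁻ x, ‖q x‖ₑ ^ m) ^ (1 / m) := by
      rw [eLpNorm_eq_lintegral_rpow_enorm_toReal hm0' hmtop, ENNReal.toReal_ofReal hm0.le]
    have hvn : eLpNorm v (ENNReal.ofReal (2 * m)) volume ^ 2 = (∫⁻ x, ‖v x‖ₑ ^ (2 * m)) ^ (1 / m) := by
      rw [eLpNorm_eq_lintegral_rpow_enorm_toReal h2m0' ENNReal.ofReal_ne_top,
        ENNReal.toReal_ofReal (by positivity), ← ENNReal.rpow_natCast, ← ENNReal.rpow_mul]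
      congr 1
      push_cast
      field_simp
    have h := hRz
    rwa [hq, hvn] at h
  -- interpolation of `∫⁻ ‖v‖ₑ^{2m} = ∫⁻ ‖w‖ₑ^m` between `2` and `6`
  have hvw : ∫⁻ x, ‖v x‖ₑ ^ (2 * m) = ∫⁻ x, ‖w x‖ₑ ^ m := by
    refine lintegral_congr fun x => ?_
    rw [hwn, ← ENNReal.rpow_mul]
  have hInterp : ∫⁻ x, ‖w x‖ₑ ^ m ≤
      (∫⁻ x, ‖w x‖ₑ ^ (2 : ℝ)) ^ ((6 - m) / (6 - 2)) * (∫⁻ x, ‖w x‖ₑ ^ (6 : ℝ)) ^ ((m - 2) / (6 - 2)) :=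
    lintegral_rpow_interpolate cw.aemeasurable.enorm zero_lt_two (by norm_num) h2m.le hm6.le
  have hW2 : (∫⁻ x, ‖v x‖ₑ ^ (2 * m)) ^ (2 / m) ≤
      ENNReal.ofReal E ^ (1 - 3 / (2 * ρ)) * ((K : ℝ≥0∞) ^ 2 * ENNReal.ofReal R) ^ (3 / (2 * ρ)) := by
    rw [hvw]
    calc (∫⁻ x, ‖w x‖ₑ ^ m) ^ (2 / m)
        ≤ ((∫⁻ x, ‖w x‖ₑ ^ (2 : ℝ)) ^ ((6 - m) / (6 - 2)) *
            (∫⁻ x, ‖w x‖ₑ ^ (6 : ℝ)) ^ ((m - 2) / (6 - 2))) ^ (2 / m) := by gcongr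
      _ = (∫⁻ x, ‖w x‖ₑ ^ (2 : ℝ)) ^ (1 - 3 / (2 * ρ)) * ((∫⁻ x, ‖w x‖ₑ ^ (6 : ℝ)) ^ (1 / (2 * ρ))) := by
          rw [ENNReal.mul_rpow_of_nonneg _ _ (by positivity), ← ENNReal.rpow_mul,
            ← ENNReal.rpow_mul, hexpθ, hexp1]
      _ ≤ (∫⁻ x, ‖w x‖ₑ ^ (2 : ℝ)) ^ (1 - 3 / (2 * ρ)) *
            ((((K : ℝ≥0∞) ^ 2 * ENNReal.ofReal R) ^ (3 : ℝ)) ^ (1 / (2 * ρ))) := by gcongr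
      _ = ENNReal.ofReal E ^ (1 - 3 / (2 * ρ)) * ((K : ℝ≥0∞) ^ 2 * ENNReal.ofReal R) ^ (3 / (2 * ρ)) := by
          rw [hEw, ← ENNReal.rpow_mul]
          congr 2; field_simp
  -- assemble in `ℝ≥0∞`
  have hN : (∫⁻ x, ‖q x‖ₑ ^ ρ) ^ (1 / ρ) = eLpNorm q r volume := by
    rw [eLpNorm_eq_lintegral_rpow_enorm_toReal hr0 hrtop, ← hρ]
  have h2mm : (∫⁻ x, ‖v x‖ₑ ^ (2 * m)) ^ (2 / m) =
      (∫⁻ x, ‖v x‖ₑ ^ (2 * m)) ^ (1 / m) * (∫⁻ x, ‖v x‖ₑ ^ (2 * m)) ^ (1 / m) := by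
    rw [← ENNReal.rpow_add_of_nonneg _ _ (by positivity) (by positivity)]
    congr 1; ring
  have hcomb : ENNReal.ofReal (∫ x, q x ^ 2 * ‖v x‖ ^ 2) ≤
      (CS : ℝ≥0∞) * eLpNorm q r volume * (ENNReal.ofReal E ^ (1 - 3 / (2 * ρ)) *
        ((K : ℝ≥0∞) ^ 2 * ENNReal.ofReal R) ^ (3 / (2 * ρ))) := by
    rw [hP]
    refine hH1.trans ?_
    rw [hN]
    calc eLpNorm q r volume * (∫⁻ x, (‖q x‖ₑ * ‖v x‖ₑ ^ (2 : ℝ)) ^ (m / 2)) ^ (2 / m)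
        ≤ eLpNorm q r volume * ((∫⁻ x, ‖q x‖ₑ ^ m) ^ (1 / m) * (∫⁻ x, ‖v x‖ₑ ^ (2 * m)) ^ (1 / m)) := by
          gcongr
      _ ≤ eLpNorm q r volume * ((CS * (∫⁻ x, ‖v x‖ₑ ^ (2 * m)) ^ (1 / m)) *
            (∫⁻ x, ‖v x‖ₑ ^ (2 * m)) ^ (1 / m)) := by gcongr
      _ = (CS : ℝ≥0∞) * eLpNorm q r volume * (∫⁻ x, ‖v x‖ₑ ^ (2 * m)) ^ (2 / m) := by
          rw [h2mm]; ring
      _ ≤ (CS : ℝ≥0∞) * eLpNorm q r volume * (ENNReal.ofReal E ^ (1 - 3 / (2 * ρ)) *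
            ((K : ℝ≥0∞) ^ 2 * ENNReal.ofReal R) ^ (3 / (2 * ρ))) := by gcongr
  -- back to reals
  have h32 : 0 ≤ 1 - 3 / (2 * ρ) := by
    rw [sub_nonneg, div_le_one (by positivity)]; linarith
  have hfin : (CS : ℝ≥0∞) * eLpNorm q r volume * (ENNReal.ofReal E ^ (1 - 3 / (2 * ρ)) *
      ((K : ℝ≥0∞) ^ 2 * ENNReal.ofReal R) ^ (3 / (2 * ρ))) ≠ ⊤ := by
    refine ENNReal.mul_ne_top (ENNReal.mul_ne_top ENNReal.coe_ne_top hqr.ne) (ENNReal.mul_ne_top ?_ ?_)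
    · exact ENNReal.rpow_ne_top_of_nonneg h32 ENNReal.ofReal_ne_top
    · exact ENNReal.rpow_ne_top_of_nonneg (by positivity)
        (ENNReal.mul_ne_top (ENNReal.pow_ne_top ENNReal.coe_ne_top) ENNReal.ofReal_ne_top)
  have := (ENNReal.ofReal_le_iff_le_toReal hfin).1 hcomb
  refine this.trans_eq ?_
  rw [ENNReal.toReal_mul, ENNReal.toReal_mul, ENNReal.toReal_mul, ← ENNReal.toReal_rpow,
    ← ENNReal.toReal_rpow, ENNReal.toReal_mul, ENNReal.toReal_pow, ENNReal.toReal_ofReal hE0,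
    ENNReal.toReal_ofReal hR0, ENNReal.coe_toReal, ENNReal.coe_toReal]
  ring

end KeyEstimate

/-! ### The pressure production of the `L⁴` energy and its absorption -/

section Production

/-- **Cauchy–Schwarz for the pressure production of the `L⁴` energy** (Lemarié-Rieusset 2016,
proof of Prop. 11.7, (11.49): `|J| ≤ 4(∫|ϖ|²|u|²)^{1/2} (∫|∇(|u|²)|²)^{1/2}`, `J = 8∫ϖ u·((u·∇)u)`,
from `u·((u·∇)u) = Σᵢ uᵢ (u·∂ᵢu) = ½ u·∇|u|²`). For a `C¹` bounded field `v` with `v, Dv ∈ L²` and a continuous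
`q ∈ L²`: `|∫ q ⟪v, (v·∇)v⟫| ≤ √(∫ q²‖v‖²) √(∫ Σᵢ⟪v, ∂ᵢv⟫²)`.
[cite: LemarieRieusset2016, §11.5 Prop. 11.7 proof, (11.49) (PDF p. 364)] -/
theorem abs_integral_mul_inner_convect_le
    {v : EuclideanSpace ℝ (Fin 3) → EuclideanSpace ℝ (Fin 3)} (hv : ContDiff ℝ 1 v)
    {B : ℝ} (hB : ∀ x, ‖v x‖ ≤ B)
    (hv0 : ∫⁻ x, ‖v x‖ₑ ^ 2 < ⊤) (hv1 : ∫⁻ x, ‖iteratedFDeriv ℝ 1 v x‖ₑ ^ 2 < ⊤)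
    {q : EuclideanSpace ℝ (Fin 3) → ℝ} (hqc : Continuous q) (hq0 : ∫⁻ x, ‖q x‖ₑ ^ 2 < ⊤) :
    |∫ x, q x * ⟪v x, FluidPDE.convect v v x⟫| ≤
      Real.sqrt (∫ x, q x ^ 2 * ‖v x‖ ^ 2) *
        Real.sqrt (∫ x, ∑ i, ⟪v x, fderiv ℝ v x (EuclideanSpace.basisFun (Fin 3) ℝ i)⟫ ^ 2) := by
  set e := EuclideanSpace.basisFun (Fin 3) ℝ with he
  have hB0 : 0 ≤ B := (norm_nonneg _).trans (hB 0)
  have cv : Continuous v := hv.continuous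
  have cdv : ∀ i, Continuous fun x => fderiv ℝ v x (e i) := fun i =>
    (hv.continuous_fderiv one_ne_zero).clm_apply continuous_const
  have n_dv : ∀ i x, ‖fderiv ℝ v x (e i)‖ ≤ ‖iteratedFDeriv ℝ 1 v x‖ := fun i x =>
    norm_fderiv_apply_basisFun_le v x i
  set G : EuclideanSpace ℝ (Fin 3) → ℝ := fun x => ∑ i, ⟪v x, fderiv ℝ v x (e i)⟫ ^ 2 with hG
  have hG0 : ∀ x, 0 ≤ G x := fun x => Finset.sum_nonneg fun i _ => sq_nonneg _
  have cG : Continuous G := continuous_finsetSum _ fun i _ => (cv.inner (cdv i)).pow 2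
  -- integrability
  have i_v2 : Integrable (fun x => ‖v x‖ ^ 2) volume :=
    FluidPDE.integrable_sq_norm_of_lintegral_lt_top cv hv0
  have i_q2 : Integrable (fun x => q x ^ 2) volume := by
    have h := FluidPDE.integrable_sq_norm_of_lintegral_lt_top hqc hq0
    refine h.congr (Eventually.of_forall fun x => ?_)
    simp only [Real.norm_eq_abs, sq_abs]
  have i_P : Integrable (fun x => q x ^ 2 * ‖v x‖ ^ 2) volume := by
    have hdom : Integrable (fun x => B ^ 2 * q x ^ 2) volume := i_q2.const_mul _
    refine hdom.mono' ((hqc.pow 2).mul (cv.norm.pow 2)).aestronglyMeasurable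
      (Eventually.of_forall fun x => ?_)
    rw [Real.norm_of_nonneg (by positivity), mul_comm (B ^ 2)]
    exact mul_le_mul_of_nonneg_left (pow_le_pow_left₀ (norm_nonneg _) (hB x) 2) (sq_nonneg _)
  have i_G : Integrable G volume := by
    have i_d1 : Integrable (fun x => ‖iteratedFDeriv ℝ 1 v x‖ ^ 2) volume :=
      FluidPDE.integrable_sq_norm_of_lintegral_lt_top (hv.continuous_iteratedFDeriv le_rfl) hv1
    have hdom : Integrable (fun x => 3 * (B ^ 2 * ‖iteratedFDeriv ℝ 1 v x‖ ^ 2)) volume :=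
      (i_d1.const_mul _).const_mul _
    refine hdom.mono' cG.aestronglyMeasurable (Eventually.of_forall fun x => ?_)
    rw [Real.norm_of_nonneg (hG0 x), hG]
    dsimp only
    have hterm : ∀ i, ⟪v x, fderiv ℝ v x (e i)⟫ ^ 2 ≤ B ^ 2 * ‖iteratedFDeriv ℝ 1 v x‖ ^ 2 := by
      intro i
      rw [← mul_pow]
      have h := abs_real_inner_le_norm (v x) (fderiv ℝ v x (e i))
      calc ⟪v x, fderiv ℝ v x (e i)⟫ ^ 2 = |⟪v x, fderiv ℝ v x (e i)⟫| ^ 2 := (sq_abs _).symm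
        _ ≤ (‖v x‖ * ‖fderiv ℝ v x (e i)‖) ^ 2 := pow_le_pow_left₀ (abs_nonneg _) h 2
        _ ≤ (B * ‖iteratedFDeriv ℝ 1 v x‖) ^ 2 :=
            pow_le_pow_left₀ (by positivity)
              (mul_le_mul (hB x) (n_dv i x) (norm_nonneg _) hB0) 2
    calc ∑ i, ⟪v x, fderiv ℝ v x (e i)⟫ ^ 2 ≤ ∑ _i : Fin 3, B ^ 2 * ‖iteratedFDeriv ℝ 1 v x‖ ^ 2 :=
          Finset.sum_le_sum fun i _ => hterm i
      _ = 3 * (B ^ 2 * ‖iteratedFDeriv ℝ 1 v x‖ ^ 2) := by simp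
  -- the two `L²` functions `f = |q| ‖v‖`, `g = √G`
  set f : EuclideanSpace ℝ (Fin 3) → ℝ := fun x => |q x| * ‖v x‖ with hf
  set g : EuclideanSpace ℝ (Fin 3) → ℝ := fun x => Real.sqrt (G x) with hg
  have hf0 : ∀ x, 0 ≤ f x := fun x => mul_nonneg (abs_nonneg _) (norm_nonneg _)
  have hg0' : ∀ x, 0 ≤ g x := fun x => Real.sqrt_nonneg _
  have cf : Continuous f := hqc.abs.mul cv.norm
  have cg : Continuous g := cG.sqrt
  have hf2 : ∀ x, f x ^ 2 = q x ^ 2 * ‖v x‖ ^ 2 := fun x => by rw [hf]; dsimp only; rw [mul_pow, sq_abs]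
  have hg2 : ∀ x, g x ^ 2 = G x := fun x => Real.sq_sqrt (hG0 x)
  have mf2 : MemLp f 2 volume := by
    refine (memLp_two_iff_integrable_sq cf.aestronglyMeasurable).2 (i_P.congr ?_)
    exact Eventually.of_forall fun x => (hf2 x).symm
  have mg2 : MemLp g 2 volume := by
    refine (memLp_two_iff_integrable_sq cg.aestronglyMeasurable).2 (i_G.congr ?_)
    exact Eventually.of_forall fun x => (hg2 x).symm
  have mf : MemLp f (ENNReal.ofReal 2) volume := by
    rw [show ENNReal.ofReal 2 = 2 by norm_num]; exact mf2
  have mg : MemLp g (ENNReal.ofReal 2) volume := by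
    rw [show ENNReal.ofReal 2 = 2 by norm_num]; exact mg2
  have i_fg : Integrable (fun x => f x * g x) volume := mf2.integrable_mul mg2
  -- pointwise bound and Cauchy–Schwarz
  have hpt : ∀ x, |q x * ⟪v x, FluidPDE.convect v v x⟫| ≤ f x * g x := fun x => by
    rw [abs_mul, hf, hg]
    dsimp only
    rw [mul_assoc]
    exact mul_le_mul_of_nonneg_left (abs_inner_convect_self_le x) (abs_nonneg _)
  have hCS := integral_mul_le_Lp_mul_Lq_of_nonneg Real.HolderConjugate.two_two
    (Eventually.of_forall hf0) (Eventually.of_forall hg0') mf mg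
  calc |∫ x, q x * ⟪v x, FluidPDE.convect v v x⟫|
      ≤ ∫ x, |q x * ⟪v x, FluidPDE.convect v v x⟫| := by
        simpa only [Real.norm_eq_abs] using
          norm_integral_le_integral_norm (fun x => q x * ⟪v x, FluidPDE.convect v v x⟫)
    _ ≤ ∫ x, f x * g x :=
        integral_mono_of_nonneg (Eventually.of_forall fun x => abs_nonneg _) i_fg
          (Eventually.of_forall hpt)
    _ ≤ (∫ x, f x ^ (2 : ℝ)) ^ (1 / (2 : ℝ)) * (∫ x, g x ^ (2 : ℝ)) ^ (1 / (2 : ℝ)) := hCS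
    _ = Real.sqrt (∫ x, q x ^ 2 * ‖v x‖ ^ 2) * Real.sqrt (∫ x, G x) := by
        rw [Real.sqrt_eq_rpow, Real.sqrt_eq_rpow]
        congr 2
        · exact integral_congr_ae (Eventually.of_forall fun x => by
            simp only [Real.rpow_two]; exact hf2 x)
        · exact integral_congr_ae (Eventually.of_forall fun x => by
            simp only [Real.rpow_two]; exact hg2 x)

end Production

/-! ### The `L⁴` slice inequality -/

section Slice

/-- Algebra of the square root of the key estimate: for `E, 𝒢, c, k ≥ 0` and `0 ≤ θ ≤ 1`,
`√(c E^θ (k 𝒢)^{1-θ}) √𝒢 = (√c · k^{(1-θ)/2}) E^{θ/2} 𝒢^{1-θ/2}`. [folklore] -/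
private theorem sqrt_mul_rpow_mul_rpow_mul_sqrt {E 𝒢 c k θ : ℝ} (hE : 0 ≤ E) (h𝒢 : 0 ≤ 𝒢)
    (hc : 0 ≤ c) (hk : 0 ≤ k) (hθ1 : θ ≤ 1) :
    Real.sqrt (c * E ^ θ * (k * 𝒢) ^ (1 - θ)) * Real.sqrt 𝒢 =
      Real.sqrt c * k ^ ((1 - θ) / 2) * E ^ (θ / 2) * 𝒢 ^ (1 - θ / 2) := by
  have hEθ : 0 ≤ E ^ θ := Real.rpow_nonneg hE _
  have hk𝒢 : 0 ≤ (k * 𝒢) ^ (1 - θ) := Real.rpow_nonneg (mul_nonneg hk h𝒢) _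
  rw [Real.sqrt_eq_rpow, Real.sqrt_eq_rpow, Real.sqrt_eq_rpow,
    Real.mul_rpow (mul_nonneg hc hEθ) hk𝒢, Real.mul_rpow hc hEθ, ← Real.rpow_mul hE,
    ← Real.rpow_mul (mul_nonneg hk h𝒢), Real.mul_rpow hk h𝒢]
  have e1 : θ * (1 / 2) = θ / 2 := by ring
  have e2 : (1 - θ) * (1 / 2) = (1 - θ) / 2 := by ring
  rw [e1, e2]
  have h𝒢pow : 𝒢 ^ ((1 - θ) / 2) * 𝒢 ^ (1 / (2 : ℝ)) = 𝒢 ^ (1 - θ / 2) := by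
    rw [← Real.rpow_add' h𝒢 (by linarith)]
    congr 1; ring
  calc c ^ (1 / (2 : ℝ)) * E ^ (θ / 2) * (k ^ ((1 - θ) / 2) * 𝒢 ^ ((1 - θ) / 2)) * 𝒢 ^ (1 / (2 : ℝ))
      = c ^ (1 / (2 : ℝ)) * k ^ ((1 - θ) / 2) * E ^ (θ / 2) * (𝒢 ^ ((1 - θ) / 2) * 𝒢 ^ (1 / (2 : ℝ))) := by
        ring
    _ = c ^ (1 / (2 : ℝ)) * k ^ ((1 - θ) / 2) * E ^ (θ / 2) * 𝒢 ^ (1 - θ / 2) := by rw [h𝒢pow]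

/-- **The `L⁴` energy inequality along a Navier–Stokes slice, pressure form** (Lemarié-Rieusset
2016, proof of Prop. 11.7, case `2/p + 3/r = 2`, `3/2 < r < ∞`, (11.47)–(11.50): the `L⁴` balance
`d/dt ‖u‖₄⁴ = -4ν∫|u|²|∇⊗u|² - 8ν∫Σᵢ(∂ᵢu·u)² + 8∫ϖ u·((u·∇)u)`, with the pressure term bounded
through `‖ϖ‖_{L^r}` and absorbed by the second dissipation term by Young's inequality). Let `v : ℝ³ → ℝ³` be `C²`, bounded, divergence free, `q : ℝ³ → ℝ` be `C¹`,
`W : ℝ³ → ℝ³` with `W + (v·∇)v = νΔv - ∇q` (`ν > 0`), `v, Dv, D²v, q, Dq ∈ L²`, `q ∈ L^r` with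
`3/2 < r < ∞`, and `‖q‖_{L^m} ≤ C_S‖v‖²_{L^{2m}}`, `m = 2r/(r-1)` (Stein's bound for the normalised
pressure). With `θ = 1 - 3/(2r)`, `Θ = θ/2 ∈ (0, 1/2)`:
`∫ 4‖v‖²⟪v, W⟫ ≤ Θ(2(1-Θ))^{(1-Θ)/Θ} (8ν)^{-(1-Θ)/Θ} (8 √(C_S‖q‖_r) (4K²)^{(1-θ)/2})^{1/Θ} ∫‖v‖⁴`
(`(C_S‖q‖_r)^{1/(2Θ)} = (C_S‖q‖_r)^{2r/(2r-3)}`: the time exponent `s` of `∇p ∈ L^s_t L^q_x`,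
`2/s + 3/q = 3`). Proof: `integral_norm_rpow_inner_eq_of_momentum` at `θ = 4`,
`abs_integral_mul_inner_convect_le`, `integral_sq_mul_sq_norm_le_of_eLpNorm_le`, and
`mul_rpow_mul_rpow_le_absorb` against half of `8ν∫Σᵢ⟪v,∂ᵢv⟫²`; the terms `-4ν∫‖v‖²|∇v|²_F` and
the other half are dropped.
[cite: LemarieRieusset2016, §11.5 Prop. 11.7 proof, (11.47)–(11.50) (PDF pp. 363–364)] -/
theorem lfour_slice_le_of_momentum {ν : ℝ} (hν : 0 < ν)
    {v W : EuclideanSpace ℝ (Fin 3) → EuclideanSpace ℝ (Fin 3)} {q : EuclideanSpace ℝ (Fin 3) → ℝ}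
    (hv : ContDiff ℝ 2 v) (hq : ContDiff ℝ 1 q)
    (hmom : ∀ x, W x + FluidPDE.convect v v x = ν • (Δ v) x - gradient q x)
    (hdiv : VectorCalculus.IsDivFree v) {B : ℝ} (hB : ∀ x, ‖v x‖ ≤ B)
    (hv0 : ∫⁻ x, ‖v x‖ₑ ^ 2 < ⊤) (hv1 : ∫⁻ x, ‖iteratedFDeriv ℝ 1 v x‖ₑ ^ 2 < ⊤)
    (hv2 : ∫⁻ x, ‖iteratedFDeriv ℝ 2 v x‖ₑ ^ 2 < ⊤)
    (hq0 : ∫⁻ x, ‖q x‖ₑ ^ 2 < ⊤) (hq1 : ∫⁻ x, ‖iteratedFDeriv ℝ 1 q x‖ₑ ^ 2 < ⊤)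
    {r : ℝ≥0∞} (hr : 3 / 2 < r) (hrtop : r ≠ ⊤) (hqr : eLpNorm q r volume < ⊤)
    {CS : ℝ≥0}
    (hRz : eLpNorm q (ENNReal.ofReal (2 * r.toReal / (r.toReal - 1))) volume ≤
      CS * eLpNorm v (ENNReal.ofReal (2 * (2 * r.toReal / (r.toReal - 1)))) volume ^ 2)
    {θ Θ : ℝ} (hθ : θ = 1 - 3 / (2 * r.toReal)) (hΘ : Θ = θ / 2) :
    ∫ x, 4 * ‖v x‖ ^ (4 - 2 : ℝ) * ⟪v x, W x⟫ ≤
      Θ * (2 * (1 - Θ)) ^ ((1 - Θ) / Θ) * (8 * ν) ^ (-((1 - Θ) / Θ)) *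
        (8 * Real.sqrt (CS * (eLpNorm q r volume).toReal) *
          (4 * (SNormLESNormFDerivOfEqConst ℝ (volume : Measure (EuclideanSpace ℝ (Fin 3))) 2 : ℝ) ^ 2) ^
            ((1 - θ) / 2)) ^ (1 / Θ) *
        ∫ x, ‖v x‖ ^ 4 := by
  set e := EuclideanSpace.basisFun (Fin 3) ℝ with he
  set K : ℝ≥0 := SNormLESNormFDerivOfEqConst ℝ (volume : Measure (EuclideanSpace ℝ (Fin 3))) 2
    with hK
  set N : ℝ := (eLpNorm q r volume).toReal with hNdef
  have hN0 : 0 ≤ N := ENNReal.toReal_nonneg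
  have hB0 : 0 ≤ B := (norm_nonneg _).trans (hB 0)
  have hv1' : ContDiff ℝ 1 v := hv.of_le (by norm_num)
  -- exponents
  have hρ3 : 3 / 2 < r.toReal := by
    have h : ((3 / 2 : ℝ≥0∞)).toReal < r.toReal :=
      (ENNReal.toReal_lt_toReal (ENNReal.div_ne_top (by norm_num) (by norm_num)) hrtop).2 hr
    have h32 : ((3 / 2 : ℝ≥0∞)).toReal = 3 / 2 := by
      rw [ENNReal.toReal_div, ENNReal.toReal_ofNat, ENNReal.toReal_ofNat]
    rw [h32] at h
    exact h
  have hρ0 : 0 < r.toReal := by linarith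
  have hθ0 : 0 < θ := by
    rw [hθ, sub_pos, div_lt_one (by positivity)]; linarith
  have hθ1 : θ < 1 := by
    rw [hθ]; have : 0 < 3 / (2 * r.toReal) := by positivity
    linarith
  have hΘ0 : 0 < Θ := by rw [hΘ]; positivity
  have hΘ1 : Θ < 1 := by rw [hΘ]; linarith
  have h3θ : 3 / (2 * r.toReal) = 1 - θ := by rw [hθ]; ring
  -- the real quantities
  have cv : Continuous v := hv.continuous
  have cdv : ∀ i, Continuous fun x => fderiv ℝ v x (e i) := fun i =>
    (hv.continuous_fderiv (by norm_num)).clm_apply continuous_const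
  have n_dv : ∀ i x, ‖fderiv ℝ v x (e i)‖ ≤ ‖iteratedFDeriv ℝ 1 v x‖ := fun i x =>
    norm_fderiv_apply_basisFun_le v x i
  set G : EuclideanSpace ℝ (Fin 3) → ℝ := fun x => ∑ i, ⟪v x, fderiv ℝ v x (e i)⟫ ^ 2 with hG
  have hG0 : ∀ x, 0 ≤ G x := fun x => Finset.sum_nonneg fun i _ => sq_nonneg _
  have cG : Continuous G := continuous_finsetSum _ fun i _ => (cv.inner (cdv i)).pow 2
  have i_d1 : Integrable (fun x => ‖iteratedFDeriv ℝ 1 v x‖ ^ 2) volume :=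
    FluidPDE.integrable_sq_norm_of_lintegral_lt_top (hv.continuous_iteratedFDeriv (by norm_num)) hv1
  have i_G : Integrable G volume := by
    have hdom : Integrable (fun x => 3 * (B ^ 2 * ‖iteratedFDeriv ℝ 1 v x‖ ^ 2)) volume :=
      (i_d1.const_mul _).const_mul _
    refine hdom.mono' cG.aestronglyMeasurable (Eventually.of_forall fun x => ?_)
    rw [Real.norm_of_nonneg (hG0 x), hG]
    dsimp only
    have hterm : ∀ i, ⟪v x, fderiv ℝ v x (e i)⟫ ^ 2 ≤ B ^ 2 * ‖iteratedFDeriv ℝ 1 v x‖ ^ 2 := by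
      intro i
      rw [← mul_pow]
      have h := abs_real_inner_le_norm (v x) (fderiv ℝ v x (e i))
      calc ⟪v x, fderiv ℝ v x (e i)⟫ ^ 2 = |⟪v x, fderiv ℝ v x (e i)⟫| ^ 2 := (sq_abs _).symm
        _ ≤ (‖v x‖ * ‖fderiv ℝ v x (e i)‖) ^ 2 := pow_le_pow_left₀ (abs_nonneg _) h 2
        _ ≤ (B * ‖iteratedFDeriv ℝ 1 v x‖) ^ 2 :=
            pow_le_pow_left₀ (by positivity)
              (mul_le_mul (hB x) (n_dv i x) (norm_nonneg _) hB0) 2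
    calc ∑ i, ⟪v x, fderiv ℝ v x (e i)⟫ ^ 2 ≤ ∑ _i : Fin 3, B ^ 2 * ‖iteratedFDeriv ℝ 1 v x‖ ^ 2 :=
          Finset.sum_le_sum fun i _ => hterm i
      _ = 3 * (B ^ 2 * ‖iteratedFDeriv ℝ 1 v x‖ ^ 2) := by simp
  -- the weighted Frobenius term is integrable and nonnegative
  set Fr : EuclideanSpace ℝ (Fin 3) → ℝ :=
    fun x => ‖v x‖ ^ (2 : ℝ) * FluidPDE.frobeniusNormSq (fderiv ℝ v x) with hFr
  have hFr0 : ∀ x, 0 ≤ Fr x := fun x =>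
    mul_nonneg (Real.rpow_nonneg (norm_nonneg _) _) (FluidPDE.frobeniusNormSq_nonneg _)
  have cFr : Continuous Fr :=
    (cv.norm.rpow_const fun _ => Or.inr (by norm_num)).mul
      (FluidPDE.continuous_frobeniusNormSq_fderiv hv (by simp))
  have i_Fr : Integrable Fr volume := by
    have hdom : Integrable (fun x => B ^ 2 * (3 * ‖iteratedFDeriv ℝ 1 v x‖ ^ 2)) volume :=
      (i_d1.const_mul _).const_mul _
    refine hdom.mono' cFr.aestronglyMeasurable (Eventually.of_forall fun x => ?_)
    rw [Real.norm_of_nonneg (hFr0 x), hFr]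
    dsimp only
    have h1 : ‖v x‖ ^ (2 : ℝ) ≤ B ^ 2 := by
      rw [Real.rpow_two]; exact pow_le_pow_left₀ (norm_nonneg _) (hB x) 2
    have h2 : FluidPDE.frobeniusNormSq (fderiv ℝ v x) ≤ 3 * ‖iteratedFDeriv ℝ 1 v x‖ ^ 2 := by
      have hn : ‖fderiv ℝ v x‖ = ‖iteratedFDeriv ℝ 1 v x‖ := by
        rw [← norm_iteratedFDeriv_fderiv, norm_iteratedFDeriv_zero]
      have h := frobeniusNormSq_le_three_mul (fderiv ℝ v x)
      rwa [hn] at h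
    exact mul_le_mul h1 h2 (FluidPDE.frobeniusNormSq_nonneg _) (sq_nonneg _)
  set E : ℝ := ∫ x, ‖v x‖ ^ 4 with hE
  set 𝒢 : ℝ := ∫ x, G x with h𝒢
  set J : ℝ := ∫ x, q x * ⟪v x, FluidPDE.convect v v x⟫ with hJ
  have hE0 : 0 ≤ E := integral_nonneg fun x => by positivity
  have h𝒢0 : 0 ≤ 𝒢 := integral_nonneg hG0
  -- Step 1: the identity at `θ = 4`
  have hI := integral_norm_rpow_inner_eq_of_momentum hv hq hmom hdiv hB (le_refl (4 : ℝ))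
    hv0 hv1 hv2 hq0 hq1
  have h42 : (4 : ℝ) - 2 = 2 := by norm_num
  have h44 : (4 : ℝ) - 4 = 0 := by norm_num
  simp only [h42, h44, Real.rpow_zero, one_mul, mul_one] at hI
  -- `hI : ∫ 4 * ‖v‖^2 * ⟪v, W⟫ = -(ν*4) * ∫ (‖v‖^2 * frob + 2 * G) + 4 * 2 * J`
  have hsplit : ∫ x, (‖v x‖ ^ (2 : ℝ) * FluidPDE.frobeniusNormSq (fderiv ℝ v x) +
      2 * ∑ i, ⟪v x, fderiv ℝ v x (e i)⟫ ^ 2) = (∫ x, Fr x) + 2 * 𝒢 := by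
    rw [h𝒢, ← integral_const_mul, ← integral_add i_Fr (i_G.const_mul _)]
  have hIFr0 : 0 ≤ ∫ x, Fr x := integral_nonneg hFr0
  -- Step 2: the production bound `8|J| ≤ a E^Θ 𝒢^{1-Θ}`
  set a : ℝ := 8 * Real.sqrt (CS * N) * (4 * (K : ℝ) ^ 2) ^ ((1 - θ) / 2) with ha
  have ha0 : 0 ≤ a := by positivity
  have hkey := integral_sq_mul_sq_norm_le_of_eLpNorm_le hv1' hB hv0 hv1 hq.continuous hq0 hr hrtop
    hqr hRz
  rw [← hθ, h3θ] at hkey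
  have hkey' : ∫ x, q x ^ 2 * ‖v x‖ ^ 2 ≤ CS * N * E ^ θ * ((K : ℝ) ^ 2 * (4 * 𝒢)) ^ (1 - θ) :=
    hkey
  have hCSb := abs_integral_mul_inner_convect_le hv1' hB hv0 hv1 hq.continuous hq0
  have hJb : 8 * |J| ≤ a * E ^ Θ * 𝒢 ^ (1 - Θ) := by
    have h1 : Real.sqrt (∫ x, q x ^ 2 * ‖v x‖ ^ 2) ≤
        Real.sqrt (CS * N * E ^ θ * ((4 * (K : ℝ) ^ 2) * 𝒢) ^ (1 - θ)) := by
      refine Real.sqrt_le_sqrt (hkey'.trans_eq ?_)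
      ring_nf
    have h2 : |J| ≤ Real.sqrt (CS * N * E ^ θ * ((4 * (K : ℝ) ^ 2) * 𝒢) ^ (1 - θ)) * Real.sqrt 𝒢 :=
      hCSb.trans (mul_le_mul_of_nonneg_right h1 (Real.sqrt_nonneg _))
    rw [sqrt_mul_rpow_mul_rpow_mul_sqrt hE0 h𝒢0 (by positivity) (by positivity) hθ1.le] at h2
    calc 8 * |J| ≤ 8 * (Real.sqrt (CS * N) * (4 * (K : ℝ) ^ 2) ^ ((1 - θ) / 2) * E ^ (θ / 2) *
        𝒢 ^ (1 - θ / 2)) := by linarith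
      _ = a * E ^ Θ * 𝒢 ^ (1 - Θ) := by rw [ha, hΘ]; ring
  -- Step 3: Young absorption against `4ν 𝒢`
  have hYoung := mul_rpow_mul_rpow_le_absorb hΘ0 hΘ1 (by positivity : 0 < 8 * ν) ha0 h𝒢0 hE0
  -- Step 4: assemble
  have hJle : 4 * 2 * J ≤ 8 * |J| := by
    have := le_abs_self J
    linarith
  rw [h42]
  calc ∫ x, 4 * ‖v x‖ ^ (2 : ℝ) * ⟪v x, W x⟫
      = -(ν * 4) * ((∫ x, Fr x) + 2 * 𝒢) + 4 * 2 * J := by rw [hI, hsplit]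
    _ ≤ -(8 * ν) * 𝒢 + 8 * |J| := by nlinarith [mul_nonneg hν.le hIFr0]
    _ ≤ -(8 * ν) * 𝒢 + a * E ^ Θ * 𝒢 ^ (1 - Θ) := by linarith
    _ ≤ -(8 * ν) * 𝒢 + (8 * ν / 2 * 𝒢 +
          Θ * (2 * (1 - Θ)) ^ ((1 - Θ) / Θ) * (8 * ν) ^ (-((1 - Θ) / Θ)) * a ^ (1 / Θ) * E) := by
        linarith
    _ ≤ Θ * (2 * (1 - Θ)) ^ ((1 - Θ) / Θ) * (8 * ν) ^ (-((1 - Θ) / Θ)) * a ^ (1 / Θ) * E := by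
        nlinarith [mul_nonneg hν.le h𝒢0]


/-- **The `L⁴` slice inequality, multiplicative form of the constant**: under the hypotheses of
`lfour_slice_le_of_momentum`,
`∫ 4‖v‖²⟪v, W⟫ ≤ C(θ, K) · (8ν)^{-(1-Θ)/Θ} · (C_S ‖q‖_{L^r})^{1/θ} · ∫‖v‖⁴` with
`C(θ, K) = Θ(2(1-Θ))^{(1-Θ)/Θ} (8 (4K²)^{(1-θ)/2})^{1/Θ}`, `θ = 1 - 3/(2r)`, `Θ = θ/2`
(`1/θ = 2r/(2r-3)` is the time exponent of the pressure class). This is the form fed to the slab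
Grönwall argument. [cite: LemarieRieusset2016, §11.5 Prop. 11.7 proof, (11.50) (PDF p. 364)] -/
theorem lfour_slice_le_of_momentum' {ν : ℝ} (hν : 0 < ν)
    {v W : EuclideanSpace ℝ (Fin 3) → EuclideanSpace ℝ (Fin 3)} {q : EuclideanSpace ℝ (Fin 3) → ℝ}
    (hv : ContDiff ℝ 2 v) (hq : ContDiff ℝ 1 q)
    (hmom : ∀ x, W x + FluidPDE.convect v v x = ν • (Δ v) x - gradient q x)
    (hdiv : VectorCalculus.IsDivFree v) {B : ℝ} (hB : ∀ x, ‖v x‖ ≤ B)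
    (hv0 : ∫⁻ x, ‖v x‖ₑ ^ 2 < ⊤) (hv1 : ∫⁻ x, ‖iteratedFDeriv ℝ 1 v x‖ₑ ^ 2 < ⊤)
    (hv2 : ∫⁻ x, ‖iteratedFDeriv ℝ 2 v x‖ₑ ^ 2 < ⊤)
    (hq0 : ∫⁻ x, ‖q x‖ₑ ^ 2 < ⊤) (hq1 : ∫⁻ x, ‖iteratedFDeriv ℝ 1 q x‖ₑ ^ 2 < ⊤)
    {r : ℝ≥0∞} (hr : 3 / 2 < r) (hrtop : r ≠ ⊤) (hqr : eLpNorm q r volume < ⊤)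
    {CS : ℝ≥0}
    (hRz : eLpNorm q (ENNReal.ofReal (2 * r.toReal / (r.toReal - 1))) volume ≤
      CS * eLpNorm v (ENNReal.ofReal (2 * (2 * r.toReal / (r.toReal - 1)))) volume ^ 2)
    {θ Θ : ℝ} (hθ : θ = 1 - 3 / (2 * r.toReal)) (hΘ : Θ = θ / 2) :
    ∫ x, 4 * ‖v x‖ ^ (4 - 2 : ℝ) * ⟪v x, W x⟫ ≤
      (Θ * (2 * (1 - Θ)) ^ ((1 - Θ) / Θ) *
          (8 * (4 * (SNormLESNormFDerivOfEqConst ℝ (volume : Measure (EuclideanSpace ℝ (Fin 3))) 2 :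
            ℝ) ^ 2) ^ ((1 - θ) / 2)) ^ (1 / Θ)) *
        (8 * ν) ^ (-((1 - Θ) / Θ)) * ((CS : ℝ) * (eLpNorm q r volume).toReal) ^ (1 / θ) *
        ∫ x, ‖v x‖ ^ 4 := by
  have h := lfour_slice_le_of_momentum hν hv hq hmom hdiv hB hv0 hv1 hv2 hq0 hq1 hr hrtop hqr hRz
    hθ hΘ
  refine h.trans_eq ?_
  set K : ℝ := (SNormLESNormFDerivOfEqConst ℝ (volume : Measure (EuclideanSpace ℝ (Fin 3))) 2 : ℝ)
    with hK
  set M : ℝ := (CS : ℝ) * (eLpNorm q r volume).toReal with hM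
  have hM0 : 0 ≤ M := mul_nonneg CS.coe_nonneg ENNReal.toReal_nonneg
  have hk0 : 0 ≤ 8 * (4 * K ^ 2) ^ ((1 - θ) / 2) := by positivity
  have hρ3 : 3 / 2 < r.toReal := by
    have h' : ((3 / 2 : ℝ≥0∞)).toReal < r.toReal :=
      (ENNReal.toReal_lt_toReal (ENNReal.div_ne_top (by norm_num) (by norm_num)) hrtop).2 hr
    have h32 : ((3 / 2 : ℝ≥0∞)).toReal = 3 / 2 := by
      rw [ENNReal.toReal_div, ENNReal.toReal_ofNat, ENNReal.toReal_ofNat]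
    rw [h32] at h'
    exact h'
  have hρ0 : 0 < r.toReal := by linarith
  have hθ0 : 0 < θ := by
    rw [hθ, sub_pos, div_lt_one (by positivity)]; linarith
  have hsq : Real.sqrt M ^ (1 / Θ) = M ^ (1 / θ) := by
    rw [Real.sqrt_eq_rpow, ← Real.rpow_mul hM0, hΘ]
    congr 1
    field_simp
  have hsplit : (8 * Real.sqrt M * (4 * K ^ 2) ^ ((1 - θ) / 2)) ^ (1 / Θ) =
      (8 * (4 * K ^ 2) ^ ((1 - θ) / 2)) ^ (1 / Θ) * M ^ (1 / θ) := by
    rw [show 8 * Real.sqrt M * (4 * K ^ 2) ^ ((1 - θ) / 2) =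
        (8 * (4 * K ^ 2) ^ ((1 - θ) / 2)) * Real.sqrt M by ring,
      Real.mul_rpow hk0 (Real.sqrt_nonneg _), hsq]
  rw [hsplit]
  ring

end Slice

end Literature.Analysis.FluidPDE

end
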